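import Literature.NumberTheory.UniformDistribution.EquidistributedModOne
import Literature.NumberTheory.UniformDistribution.EquidistributedModOnePi
import HarnessLib

/-!
# Kronecker sequences `(nθ₁, …, nθ_s)` are uniformly distributed modulo one

Topic `Literature/NumberTheory/UniformDistribution` (third file of the definition request
`defn-EquidistributedModOne`, wanted by `route-Schanuel-BenfordTowers`). Everything here is PROVED.

Source: L. Kuipers, H. Niederreiter, *Uniform distribution of sequences* (Wiley 1974), Ch. 1 §6,
p. 48 [KuipersNiederreiter1974].

* `equidistributedModOnePi_iff_forall_equidistributedModOne` — **Theorem 6.3**: a sequence `x` of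
  vectors is u.d. mod 1 in `ℝ^ι` iff for every lattice point `h ≠ 0` the real sequence
  `(⟨h, x n⟩)_n` is u.d. mod 1 ("this follows immediately from Theorems 6.2 and 2.1").
* `equidistributedModOnePi_nat_mul` — **Example 6.1 (Kronecker–Weyl)**: if `⟨h, θ⟩` is
  irrational for every lattice point `h ≠ 0` — equivalently (`Fin` version
  `equidistributedModOnePi_nat_mul_fin`) if `1, θ₁, …, θ_s` are linearly independent over `ℚ` —
  then `(nθ)_n = ((nθ₁, …, nθ_s))_n` is u.d. mod 1 in `ℝ^s`.
* `EquidistributedModOne.int_mul`, `equidistributedModOne_iff_pi` — the one-dimensional notion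
  `EquidistributedModOne` is the case `ι = Fin 1` of `EquidistributedModOnePi`.

## References

* [KuipersNiederreiter1974] L. Kuipers, H. Niederreiter, *Uniform distribution of sequences*, Wiley
  1974, Ch. 1 §6, Theorem 6.3 and Example 6.1 (p. 48); Ch. 1 §2, Theorem 2.1 (p. 7).
* [Weyl1916] H. Weyl, *Über die Gleichverteilung von Zahlen mod. Eins*, Math. Ann. 77 (1916) 313–352.
-/

noncomputable section

open Filter Topology Asymptotics

namespace Literature.NumberTheory.UniformDistribution

variable {ι : Type*} [Fintype ι]

/-- The Weyl sum of the real sequence `⟨h, x n⟩` at frequency `k` is the Weyl sum of `x` at the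
lattice point `k • h` (equality of the phases). [folklore] -/
theorem int_mul_sum_eq_sum_smul (k : ℤ) (h : ι → ℤ) (y : ι → ℝ) :
    (k : ℝ) * ∑ i, (h i : ℝ) * y i = ∑ i, ((k • h) i : ℝ) * y i := by
  rw [Finset.mul_sum]
  refine Finset.sum_congr rfl fun i _ => ?_
  rw [Pi.smul_apply, smul_eq_mul, Int.cast_mul, mul_assoc]

/-- **K–N Theorem 6.3.** A sequence `x` of vectors is u.d. mod 1 in `ℝ^ι` if and only if for every
lattice point `h ≠ 0` the sequence of real numbers `(⟨h, x n⟩)_n = (Σ_i h_i (x n)_i)_n` is u.d. mod 1.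
(Proof: Theorems 6.2 and 2.1.) [cite: KuipersNiederreiter1974, Ch. 1, Theorem 6.3] -/
theorem equidistributedModOnePi_iff_forall_equidistributedModOne (x : ℕ → ι → ℝ) :
    EquidistributedModOnePi x ↔
      ∀ h : ι → ℤ, h ≠ 0 → EquidistributedModOne fun n => ∑ i, (h i : ℝ) * x n i := by
  rw [equidistributedModOnePi_iff_weyl]
  constructor
  · intro hx h hh
    rw [equidistributedModOne_iff_weyl]
    intro k hk
    refine (hx (k • h) (smul_ne_zero hk hh)).congr_left fun N => Finset.sum_congr rfl fun n _ => ?_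
    rw [int_mul_sum_eq_sum_smul]
  · intro H h hh
    have h1 := (equidistributedModOne_iff_weyl _).1 (H h hh) 1 one_ne_zero
    refine h1.congr_left fun N => Finset.sum_congr rfl fun n _ => ?_
    rw [Int.cast_one, one_mul]

/-- **Multiplication by a nonzero integer** preserves u.d. mod 1 (Weyl's criterion at the
frequencies `kh`). [folklore] -/
theorem EquidistributedModOne.int_mul {u : ℕ → ℝ} (hu : EquidistributedModOne u) {m : ℤ}
    (hm : m ≠ 0) : EquidistributedModOne fun n => (m : ℝ) * u n := by
  rw [equidistributedModOne_iff_weyl] at hu ⊢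
  intro k hk
  refine (hu (k * m) (mul_ne_zero hk hm)).congr_left fun N => Finset.sum_congr rfl fun n _ => ?_
  congr 1
  push_cast
  ring

/-- **The one-dimensional notion is the case `ι = Fin 1`** of u.d. mod 1 in `ℝ^ι`. [folklore] -/
theorem equidistributedModOne_iff_pi (u : ℕ → ℝ) :
    EquidistributedModOne u ↔ EquidistributedModOnePi fun (n : ℕ) (_ : Fin 1) => u n := by
  rw [equidistributedModOnePi_iff_forall_equidistributedModOne]
  constructor
  · intro hu h hh
    have h0 : h 0 ≠ 0 := by
      intro h0
      apply hh
      funext i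
      rw [Fin.fin_one_eq_zero i, h0, Pi.zero_apply]
    simpa only [Fin.sum_univ_one] using hu.int_mul h0
  · intro H
    simpa only [Fin.sum_univ_one, Pi.one_apply, Int.cast_one, one_mul] using
      H 1 (one_ne_zero)

/-- **Kronecker–Weyl equidistribution theorem, K–N Example 6.1** (general index type, hypothesis
in the form used in K–N's proof): if `⟨h, θ⟩ = Σ_i h_i θ_i` is irrational for every lattice point
`h ≠ 0`, then `(nθ)_n` is u.d. mod 1 in `ℝ^ι`. [cite: KuipersNiederreiter1974, Ch. 1, Example 6.1] -/
theorem equidistributedModOnePi_nat_mul (θ : ι → ℝ)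
    (hθ : ∀ h : ι → ℤ, h ≠ 0 → Irrational (∑ i, (h i : ℝ) * θ i)) :
    EquidistributedModOnePi fun (n : ℕ) (i : ι) => (n : ℝ) * θ i := by
  rw [equidistributedModOnePi_iff_forall_equidistributedModOne]
  intro h hh
  have hrw : (fun n : ℕ => ∑ i, (h i : ℝ) * ((n : ℝ) * θ i)) =
      fun n : ℕ => (n : ℝ) * ∑ i, (h i : ℝ) * θ i := by
    funext n
    rw [Finset.mul_sum]
    exact Finset.sum_congr rfl fun i _ => by ring
  rw [hrw]
  exact equidistributedModOne_nat_mul (hθ h hh)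

/-- If `1, θ₁, …, θ_m` are linearly independent over `ℚ`, then `⟨h, θ⟩` is irrational for every
lattice point `h ≠ 0`. [folklore] -/
theorem irrational_sum_mul_of_linearIndependent {m : ℕ} {θ : Fin m → ℝ}
    (hli : LinearIndependent ℚ (Fin.cons (1 : ℝ) θ : Fin (m + 1) → ℝ)) {h : Fin m → ℤ}
    (hh : h ≠ 0) : Irrational (∑ i, (h i : ℝ) * θ i) := by
  rintro ⟨q, hq⟩
  have hrel : ∑ j : Fin (m + 1), (Fin.cons (-q) (fun i => (h i : ℚ)) : Fin (m + 1) → ℚ) j •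
      (Fin.cons (1 : ℝ) θ : Fin (m + 1) → ℝ) j = 0 := by
    rw [Fin.sum_univ_succ]
    simp only [Fin.cons_zero, Fin.cons_succ, Rat.smul_def, Rat.cast_neg, Rat.cast_intCast, mul_one]
    rw [← hq]
    ring
  have hzero := Fintype.linearIndependent_iff.1 hli _ hrel
  apply hh
  funext i
  have := hzero i.succ
  simp only [Fin.cons_succ, Int.cast_eq_zero] at this
  rw [this, Pi.zero_apply]

/-- **Kronecker–Weyl, K–N Example 6.1** (`ℝ^m` version): if `1, θ₁, …, θ_m` are linearly independent
over `ℚ` then `((nθ₁, …, nθ_m))_n` is u.d. mod 1 in `ℝ^m`. [cite: KuipersNiederreiter1974, Ch. 1, Example 6.1] -/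
theorem equidistributedModOnePi_nat_mul_fin {m : ℕ} {θ : Fin m → ℝ}
    (hli : LinearIndependent ℚ (Fin.cons (1 : ℝ) θ : Fin (m + 1) → ℝ)) :
    EquidistributedModOnePi fun (n : ℕ) (i : Fin m) => (n : ℝ) * θ i :=
  equidistributedModOnePi_nat_mul θ fun _ hh => irrational_sum_mul_of_linearIndependent hli hh

/-- Kronecker–Weyl in Weyl-sum form: under the same hypothesis, for every lattice point `h ≠ 0`,
`Σ_{n<N} e(n ⟨h, θ⟩) = o(N)`. [cite: KuipersNiederreiter1974, Ch. 1, Example 6.1] -/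
theorem isLittleO_sum_exp_nat_mul_of_linearIndependent {m : ℕ} {θ : Fin m → ℝ}
    (hli : LinearIndependent ℚ (Fin.cons (1 : ℝ) θ : Fin (m + 1) → ℝ)) {h : Fin m → ℤ} (hh : h ≠ 0) :
    (fun N : ℕ => ∑ n ∈ Finset.range N,
        Complex.exp (2 * Real.pi * Complex.I * ((∑ i, (h i : ℝ) * ((n : ℝ) * θ i) : ℝ) : ℂ))) =o[atTop]
      fun N : ℕ => (N : ℝ) :=
  (equidistributedModOnePi_iff_weyl _).1 (equidistributedModOnePi_nat_mul_fin hli) h hh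

end Literature.NumberTheory.UniformDistribution

end
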